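import Summits.Parity.Statement
import Literature.StrongHypotheses.Parity
import Summits.Parity.GeneralizedHardyLittlewood.Theorems.GeneralizedHardyLittlewoodDimOnePosition
import Summits.Parity.GeneralizedHardyLittlewood.Cruxes.DimOne.StrategistSketch
import Summits.Parity.BatemanHorn.Cruxes.PolyMobiusTail.Disproof
import Summits.Parity.BatemanHorn.Cruxes.PolyMobiusTail.StrategyCensus
import Summits.Parity.BatemanHorn.Theorems.PolynomialMobiusPolyMobiusTailSummitEquivalence
import HarnessLib
import HarnessLib.Audit.TribunalTags

/-!
# Summit `Parity` — bridges of the Strong-Hypothesis Library (D-0034, skeleton)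

Summit-side REGISTRY + BRIDGE file for `Literature/StrongHypotheses/Parity.lean` (read its module
docstring first: the census, and why the Literature side of this summit registers nothing).

All five registrations of this summit are summit-side closed `Prop`s written by crux strategists /
provers under `Summits/Parity/**/{Cruxes,Theorems}` (never `Theses` decls), tagged HERE with
`attribute [strong_hypothesis "Parity.<P>"]` because Literature cannot import `Summits.*`; for each,
exactly ONE bridge tagged `@[summit_bridge "Parity.<P>"]`, concluding the ROOT problem decl
(`_root_.BatemanHorn`, `_root_.GeneralizedHardyLittlewood`; both are `abbrev`s of the Literature
statements). Every bridge is LANDED — a one-line composition of theorems already proved in the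
imported (built) modules; there are NO printed bridges, hence no stubs to farm.

| `H` / `E` | problem | relation | bridge |
|---|---|---|---|
| `GeneralizedHardyLittlewoodDimOne` | GHL | equivalent | `generalizedHardyLittlewoodDimOne_iff_generalizedHardyLittlewood` |
| `Cruxes.DimOne.BirthSieve.TwoFlatFactorsCore` | GHL | equivalent | `twoFlatFactorsCore_iff_generalizedHardyLittlewood` |
| `Cruxes.DimOne.Strategist.PowerSavingDimOne` | GHL | strictly stronger | `generalizedHardyLittlewood_of_powerSavingDimOne` |
| `Cruxes.PolyMobiusTail.Disproof.LambdaBatemanHorn` | BH | equivalent | `lambdaBatemanHorn_iff_batemanHorn` |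
| `Cruxes.PolyMobiusTail.StrategyCensus.PolyMobiusTailPowerSaving` | BH | strictly stronger | `batemanHorn_of_polyMobiusTailPowerSaving` |

No new mathematics is proved here; no `sorry`, no axiom.
-/

noncomputable section

/-! ## Summit-side hypothesis / criterion `def`s, tagged in place (no restatement) -/

attribute [strong_hypothesis "Parity.GeneralizedHardyLittlewood"]
  Summit.Parity.GeneralizedHardyLittlewood.GeneralizedHardyLittlewoodDimOne
  Summit.Parity.GeneralizedHardyLittlewood.Cruxes.DimOne.BirthSieve.TwoFlatFactorsCore
  Summit.Parity.GeneralizedHardyLittlewood.Cruxes.DimOne.Strategist.PowerSavingDimOne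

attribute [strong_hypothesis "Parity.BatemanHorn"]
  Summit.Parity.BatemanHorn.Cruxes.PolyMobiusTail.Disproof.LambdaBatemanHorn
  Summit.Parity.BatemanHorn.Cruxes.PolyMobiusTail.StrategyCensus.PolyMobiusTailPowerSaving

namespace Summit.Parity.StrongHypotheses

open Summit.Parity.GeneralizedHardyLittlewood
open Summit.Parity.GeneralizedHardyLittlewood.Cruxes.DimOne

/-! ## `GeneralizedHardyLittlewood`: equivalent criteria (landed) -/

/-- **One-variable case ⇔ GHL** (landed): Green–Tao's Conjecture 1.2 in all dimensions is equivalent to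
its `d = 1` case (Dickson–Hardy–Littlewood tuples with `Λ`-weights, uniform in the shifts): `→` by the
fibration lemma `Theses.DicksonFibration.Assembly_holds`, `←` by specialisation; in tree as
`generalizedHardyLittlewood_iff_generalizedHardyLittlewoodDimOne` (`Theorems/GeneralizedHardyLittlewoodDimOnePosition`).
[cite: GreenTao2010, Conj. 1.2 and §1] -/
@[summit_bridge "Parity.GeneralizedHardyLittlewood"]
theorem generalizedHardyLittlewoodDimOne_iff_generalizedHardyLittlewood :
    GeneralizedHardyLittlewoodDimOne ↔ _root_.GeneralizedHardyLittlewood :=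
  generalizedHardyLittlewood_iff_generalizedHardyLittlewoodDimOne.symm

/-- **Admissible rough-vs-rough core ⇔ GHL** (landed): `TwoFlatFactorsCore` (`t ≥ 2`, `β_p > 0` at every
prime, `|∑_{#T ≥ 2} corrTerm T| ≤ εN` uniformly) is equivalent to the one-variable case
(`twoFlatFactorsCore_iff_generalizedHardyLittlewoodDimOne`, over the proved perimeter peel), hence to GHL.
[cite: GreenTao2010, Conj. 1.2 and §12 (12.3)] -/
@[summit_bridge "Parity.GeneralizedHardyLittlewood"]
theorem twoFlatFactorsCore_iff_generalizedHardyLittlewood :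
    BirthSieve.TwoFlatFactorsCore ↔ _root_.GeneralizedHardyLittlewood :=
  twoFlatFactorsCore_iff_generalizedHardyLittlewoodDimOne.trans
    generalizedHardyLittlewoodDimOne_iff_generalizedHardyLittlewood

/-! ## `GeneralizedHardyLittlewood`: strictly stronger hypothesis (landed) -/

/-- **Power-saving one-variable GHL ⟹ GHL** (landed): the strategist's `S⁺` (error `≤ N^{1−δ}` uniformly)
implies the one-variable case (`Strategist.dimOne_of_powerSavingDimOne`, `x^{1−δ} = o(x)`), which implies
GHL by the fibration lemma `Theses.DicksonFibration.Assembly_holds`. [folklore] -/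
@[summit_bridge "Parity.GeneralizedHardyLittlewood"]
theorem generalizedHardyLittlewood_of_powerSavingDimOne
    (h : Strategist.PowerSavingDimOne) : _root_.GeneralizedHardyLittlewood :=
  Theses.DicksonFibration.Assembly_holds (Strategist.dimOne_of_powerSavingDimOne h)

/-! ## `BatemanHorn`: equivalent criterion (landed) -/

/-- **`Λ`-form of Bateman–Horn ⇔ Bateman–Horn** (landed): `∑_{n ≤ x} ∏ᵢ Λ(fᵢ(n)) ∼ C(f)·x` for every
Bateman–Horn system is equivalent to the count form (the summit conjunct). Composition of
`Cruxes.PolyMobiusTail.Disproof.polyMobiusTail_iff_lambdaBatemanHorn` (with the tree theorem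
`Theorems.typeIMainTerm_proof`) and `Theorems.PolyMobiusTail.SummitEquivalence.polyMobiusTail_isogenyRedei_iff_batemanHorn`
(over `lambdaToCount_proof` and `lambda_isEquivalent_of_batemanHornAsymptotic`: partial summation both ways).
[cite: BatemanHornMathComp1962, (1)–(2)] -/
@[summit_bridge "Parity.BatemanHorn"]
theorem lambdaBatemanHorn_iff_batemanHorn :
    Summit.Parity.BatemanHorn.Cruxes.PolyMobiusTail.Disproof.LambdaBatemanHorn ↔ _root_.BatemanHorn :=
  (Summit.Parity.BatemanHorn.Cruxes.PolyMobiusTail.Disproof.polyMobiusTail_iff_lambdaBatemanHorn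
      Summit.Parity.BatemanHorn.Theorems.typeIMainTerm_proof).symm.trans
    Summit.Parity.BatemanHorn.Theorems.PolyMobiusTail.SummitEquivalence.polyMobiusTail_isogenyRedei_iff_batemanHorn

/-! ## `BatemanHorn`: strictly stronger hypothesis (landed) -/

/-- **Power-saving Möbius-tail cancellation ⟹ Bateman–Horn** (landed): the strategist's `S⁺₂`
(large-divisor tail `O(x^{1−δ})` for every system; the shape of the Sawin–Shusterman `𝔽_q[u]` theorems)
implies the crux `PolyMobiusTail` (`StrategyCensus.polyMobiusTail_of_powerSaving`), which implies the summit
conjunct outright (`StrategyCensus.batemanHorn_of_polyMobiusTail`, the route's `closes` with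
`typeIMainTerm_proof` and `lambdaToCount_proof`). [folklore] -/
@[summit_bridge "Parity.BatemanHorn"]
theorem batemanHorn_of_polyMobiusTailPowerSaving
    (h : Summit.Parity.BatemanHorn.Cruxes.PolyMobiusTail.StrategyCensus.PolyMobiusTailPowerSaving) :
    _root_.BatemanHorn :=
  Summit.Parity.BatemanHorn.Cruxes.PolyMobiusTail.StrategyCensus.batemanHorn_of_polyMobiusTail
    (Summit.Parity.BatemanHorn.Cruxes.PolyMobiusTail.StrategyCensus.polyMobiusTail_of_powerSaving h)

end Summit.Parity.StrongHypotheses
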